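import Summits.Ventures.LatticeQCDFlow.Scaling.TightSectorGapLaw
import Summits.Ventures.LatticeQCDFlow.Scaling.HalfSwapStarRecipe

/-!
HONEST FRAMING: exact (Metropolis-corrected) sampling algorithms for lattice gauge theory; figures
of merit are autocorrelation/cost numbers at stated couplings and volumes; no continuum-physics
claim.

# TightSectorMixingFloor — THE COLD-START MIXING TIME OF THE MAP-ASSISTED HOT-REFRESHED HUB IS AT LEAST
# `((1−θ)K/(p'·min{t, (1−t)w_0}) − 1)·log(1/(2ε))` AT A TIGHT SECTOR: THE `1/p` OF EVERY CHAPTER-N MIXING CEILING IS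
# NECESSARY; AT HALF SWAPS `(2(1−θ)K/p' − 1)·log(1/(2ε)) ≤ t_mix(ε) ≤ ⌈(14K/p)·log(1/(2ε·π̃_min))⌉` (lean-2 GEN-29, ours)

Venture-side (OURS).  Cell `lqcd-flow` (pub-lqcd), unit `pub-lqcd-lean-2-g29`, 2026-08-28.  Chapter O (the floor sees the map
quality), file 2.  `Scaling/TightSectorGapLaw` (O1) bounded the relaxation time of the chapter-M/N scheme from below by
`(1−θ)K/(p'·min{t,(1−t)w_0})` at a tight sector (`A` preserved by the entry maps, cold mass `θ ∈ (0,1)` at every cold level, hot mass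
`≤ p'θ`; `p ≤ p'` forced, `p' = p` allowed); Levin–Peres–Wilmer eq. (12.14) (`(t_rel − 1)·log(1/(2ε)) ≤ t_mix(ε)`, in the tree) turns it
into a cold-start floor.  The chain is `ε`-close to `π̃` at some time by chapter N's own ceiling (`Scaling/DominatedStarRegimeFreeTimeAverages`),
so no closeness hypothesis is carried.

## What is proved

* `dominatedStar_exists_worstTvDist_le` — the scheme is `ε`-close to `π̃` at some time, for every `ε > 0` (N8 at `π̃_min = min π̃`).
* `dominatedStar_lambdaStar_lt_one` — `λ⋆ < 1` (N4's `γ⋆ ≥ G > 0`).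
* **`tightSector_mixingTime_ge`** — `0 < t < 1`, `w_0 > 0`, exact hot redraws, one-sided domination `p ∈ (0,1]`, multiplicities `≥ c ≥ 1`,
  tight sector, sector-idle reversible cold kernels, `ε > 0`:
  **`((1−θ)K/(p'·min{t, (1−t)w_0}) − 1)·log(1/(2ε)) ≤ t_mix(ε)`**.
* **`halfStar_tightSector_mixingTime_two_sided`** — `t = ½`, `w_0 = 1`, `m ≤ cK`:
  **`(2(1−θ)K/p' − 1)·log(1/(2ε)) ≤ t_mix(ε) ≤ ⌈(14K/p)·log(1/(2ε·π̃_min))⌉`**.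

Reading (no numerics implied): from a cold start the map-assisted hub over `K` sector-idle replicas cannot be `ε`-close before order
`K/p'` steps — order `K/(p'·t)` because a replica relaxes no faster than it is handed a transported hot configuration it accepts, order
`K/(p'·(1−t)w_0)` because the sector census relaxes no faster than the hot level mints the rare label —, against chapter N's ceilings of order
`(K/p)·log(1/π̃_min)` (`ℓ²`), `(K/(p·α₀))·log log(1/π̃_min)` (log-Sobolev) and the volume-free laws of `Scaling/TwoLevelRegimeFreeDoeblin` /
`Scaling/DominatedStarVolumeFreeDoeblin`: the map quality is paid exactly once in the cold-start law too; only the logarithm (item 1) separates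
the two sides.  NOT CLAIMED: a floor carrying `log K` together with `1/p'` (OPEN-MATH item 7/8, floor side); anything measured.  Literature
grade (cell rule): OWN COROLLARY (O1 + LPW eq. (12.14) as typed + N8/N17); nothing cited as a fact; no new bib keys.
-/

noncomputable section

open Finset Function
open Literature.Probability.MarkovChains

namespace Summit.Ventures.LatticeQCDFlow.Scaling

variable {S : Type*} [Fintype S] [DecidableEq S] {K m : ℕ} {μ : Fin (K + 1) → S → ℝ} {M : Fin (K + 1) → S → S → ℝ}
  {w : Fin (K + 1) → ℝ} {t p : ℝ}

section Floor
variable (κ : Fin m → Fin K) (φ : Fin m → Equiv.Perm S)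

/-- **The scheme is `ε`-close to `π̃` at some time** (`ε > 0`): chapter N's regime-free `ℓ²` ceiling at `π̃_min = min_x π̃(x)`. [ours] -/
theorem dominatedStar_exists_worstTvDist_le [Nontrivial S] (hK : 1 ≤ K) (hm : 1 ≤ m) (ht0 : 0 < t) (ht1 : t < 1)
    (hw0 : ∀ k, 0 ≤ w k) (hw00 : 0 < w 0) (hw1 : ∑ k, w k = 1) (hμ : ∀ k x, 0 < μ k x)
    (hμ1 : ∀ k, ∑ u, μ k u = 1) (hM : ∀ k, IsRowStochastic (M k)) (hMrev : ∀ k, DetailedBalance (μ k) (M k))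
    (hM0 : ∀ u v, M 0 u v = μ 0 v) (hp0 : 0 < p) (hp1 : p ≤ 1) (hdom : ∀ r u, p * μ (κ r).succ (φ r u) ≤ μ 0 u)
    {c : ℕ} (hc1 : 1 ≤ c) (hc : ∀ p' : Fin K, c ≤ (univ.filter (fun r : Fin m => κ r = p')).card) {ε : ℝ} (hε : 0 < ε) :
    ∃ n : ℕ, worstTvDist (fun y z : Fin (K + 1) → S =>
        t * ptGraphSwap μ (fun r : Fin m => (((0 : Fin (K + 1)), (κ r).succ) : Fin (K + 1) × Fin (K + 1))) φ y z
          + (1 - t) * prodKernel w M y z) (tensorFun μ) n ≤ ε := by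
  -- `π̃_min` over the finite nonempty configuration space
  obtain ⟨x₀, -, hx₀⟩ := Finset.exists_min_image (univ : Finset (Fin (K + 1) → S)) (tensorFun μ) univ_nonempty
  refine ⟨⌈1 / (p * min (c * t / (3 * m)) ((1 - t) * w 0 / (7 * K))) * Real.log (1 / (2 * ε * tensorFun μ x₀))⌉₊, ?_⟩
  exact dominatedStar_worstTvDist_le_regimeFree κ φ hK hm ht0 ht1 hw0 hw00 hw1 hμ hμ1 hM hMrev hM0 hp0 hp1 hdom hc1 hc
    (tensorFun_pos hμ x₀) (fun x => hx₀ x (mem_univ x)) hε (Nat.le_ceil _)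

/-- **`λ⋆ < 1`** for the scheme (`γ⋆ ≥ p·min{ct/(3m), (1−t)w_0/(7K)} > 0`, `Scaling/DominatedStarRegimeFreeRelaxation`). [ours] -/
theorem dominatedStar_lambdaStar_lt_one [Nontrivial S] (hK : 1 ≤ K) (hm : 1 ≤ m) (ht0 : 0 < t) (ht1 : t < 1)
    (hw0 : ∀ k, 0 ≤ w k) (hw00 : 0 < w 0) (hw1 : ∑ k, w k = 1) (hμ : ∀ k x, 0 < μ k x)
    (hμ1 : ∀ k, ∑ u, μ k u = 1) (hM : ∀ k, IsRowStochastic (M k)) (hMrev : ∀ k, DetailedBalance (μ k) (M k))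
    (hM0 : ∀ u v, M 0 u v = μ 0 v) (hp0 : 0 < p) (hp1 : p ≤ 1) (hdom : ∀ r u, p * μ (κ r).succ (φ r u) ≤ μ 0 u)
    {c : ℕ} (hc1 : 1 ≤ c) (hc : ∀ p' : Fin K, c ≤ (univ.filter (fun r : Fin m => κ r = p')).card) :
    lambdaStar (fun y z : Fin (K + 1) → S =>
        t * ptGraphSwap μ (fun r : Fin m => (((0 : Fin (K + 1)), (κ r).succ) : Fin (K + 1) × Fin (K + 1))) φ y z
          + (1 - t) * prodKernel w M y z) < 1 := by
  have hKpos : (0 : ℝ) < K := Nat.cast_pos.mpr (by omega)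
  have hmpos : (0 : ℝ) < m := Nat.cast_pos.mpr (by omega)
  have hcpos : (0 : ℝ) < c := Nat.cast_pos.mpr (by omega)
  have h1t : 0 < 1 - t := by linarith
  have h := dominatedStar_absSpectralGap_ge_regimeFree κ φ hK hm ht0 ht1 hw0 hw00 hw1 hμ hμ1 hM hMrev hM0 hp0 hp1 hdom hc1 hc
  have hG : 0 < p * min (c * t / (3 * m)) ((1 - t) * w 0 / (7 * K)) := mul_pos hp0 (lt_min (by positivity) (by positivity))
  unfold absSpectralGap at h
  linarith

/-- **THE COLD-START FLOOR AT A TIGHT SECTOR: `((1−θ)K/(p'·min{t, (1−t)w_0}) − 1)·log(1/(2ε)) ≤ t_mix(ε)`** (`0 < ε ≤ ½`; hypotheses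
of `Scaling/TightSectorGapLaw`'s law; no closeness hypothesis — the chain converges). [ours] -/
theorem tightSector_mixingTime_ge [Nontrivial S] (hK : 1 ≤ K) (hm : 1 ≤ m) (ht0 : 0 < t) (ht1 : t < 1)
    (hw0 : ∀ k, 0 ≤ w k) (hw00 : 0 < w 0) (hw1 : ∑ k, w k = 1) (hμ : ∀ k x, 0 < μ k x)
    (hμ1 : ∀ k, ∑ u, μ k u = 1) (hM : ∀ k, IsRowStochastic (M k)) (hMrev : ∀ k, DetailedBalance (μ k) (M k))
    (hM0 : ∀ u v, M 0 u v = μ 0 v) (hp0 : 0 < p) (hp1 : p ≤ 1) (hdom : ∀ r u, p * μ (κ r).succ (φ r u) ≤ μ 0 u)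
    {c : ℕ} (hc1 : 1 ≤ c) (hc : ∀ p' : Fin K, c ≤ (univ.filter (fun r : Fin m => κ r = p')).card)
    {A : Finset S} (hφA : ∀ r u, φ r u ∈ A ↔ u ∈ A) {θ p' : ℝ} (hθ0 : 0 < θ) (hθ1 : θ < 1)
    (hcold : ∀ k : Fin (K + 1), k ≠ 0 → ∑ u ∈ A, μ k u = θ) (hhot : ∑ u ∈ A, μ 0 u ≤ p' * θ)
    (hidle : ∀ k : Fin (K + 1), k ≠ 0 → w k * edgeMeasure (μ k) (M k) A Aᶜ = 0) {ε : ℝ} (hε : 0 < ε) (hε2 : ε ≤ 1 / 2) :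
    ((1 - θ) * K / (p' * min t ((1 - t) * w 0)) - 1) * Real.log (1 / (2 * ε))
      ≤ (mixingTime (fun y z : Fin (K + 1) → S =>
            t * ptGraphSwap μ (fun r : Fin m => (((0 : Fin (K + 1)), (κ r).succ) : Fin (K + 1) × Fin (K + 1))) φ y z
              + (1 - t) * prodKernel w M y z) (tensorFun μ) ε : ℝ) := by
  set e : Fin m → Fin (K + 1) × Fin (K + 1) := fun r => (((0 : Fin (K + 1)), (κ r).succ) : Fin (K + 1) × Fin (K + 1))
    with he_def
  set P : (Fin (K + 1) → S) → (Fin (K + 1) → S) → ℝ := fun y z => t * ptGraphSwap μ e φ y z + (1 - t) * prodKernel w M y z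
    with hPdef
  have hPst : IsRowStochastic P :=
    weightedScheme_isRowStochastic (ptGraphSwap_isRowStochastic (e := e) (φ := φ) hμ) hM hw0 hw1 ht0.le ht1.le
  have hDB : DetailedBalance (tensorFun μ) P :=
    weightedScheme_detailedBalance (w := w) (ptGraphSwap_detailedBalance (e := e) (φ := φ) hμ) hMrev t
  have hst : IsStationary (tensorFun μ) P := hDB.isStationary hPst.2
  have hlam := dominatedStar_lambdaStar_lt_one κ φ hK hm ht0 ht1 hw0 hw00 hw1 hμ hμ1 hM hMrev hM0 hp0 hp1 hdom hc1 hc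
  have hmix := dominatedStar_exists_worstTvDist_le κ φ hK hm ht0 ht1 hw0 hw00 hw1 hμ hμ1 hM hMrev hM0 hp0 hp1 hdom hc1 hc hε
  have h1214 := LevinPeres2017_eq_12_14_tmix hst hlam hε hmix
  have hrel := tightSector_relaxationTime_ge κ φ hK hm ht0 ht1 hw0 hw00 hw1 hμ hμ1 hM hMrev hM0 hp0 hp1 hdom hc1 hc hφA hθ0 hθ1
    hcold hhot hidle
  have hlog : 0 ≤ Real.log (1 / (2 * ε)) :=
    Real.log_nonneg (by rw [le_div_iff₀ (by positivity)]; linarith)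
  exact (mul_le_mul_of_nonneg_right (by linarith) hlog).trans h1214

/-- **AT HALF SWAPS THE COLD-START LAW IS LINEAR IN THE QUALITY FROM BOTH SIDES** (`t = ½`, `w_0 = 1`, `m ≤ cK`, tight sector, `0 < ε ≤ ½`,
`π̃ ≥ π̃_min > 0`): **`(2(1−θ)K/p' − 1)·log(1/(2ε)) ≤ t_mix(ε) ≤ ⌈(14K/p)·log(1/(2ε·π̃_min))⌉`** (this file and `Scaling/HalfSwapStarRecipe`).
[ours] -/
theorem halfStar_tightSector_mixingTime_two_sided [Nontrivial S] (hK : 1 ≤ K) (hm : 1 ≤ m) (hw0 : ∀ k, 0 ≤ w k)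
    (hw01 : w 0 = 1) (hw1 : ∑ k, w k = 1) (hμ : ∀ k x, 0 < μ k x) (hμ1 : ∀ k, ∑ u, μ k u = 1)
    (hM : ∀ k, IsRowStochastic (M k)) (hMrev : ∀ k, DetailedBalance (μ k) (M k)) (hM0 : ∀ u v, M 0 u v = μ 0 v)
    (hp0 : 0 < p) (hp1 : p ≤ 1) (hdom : ∀ r u, p * μ (κ r).succ (φ r u) ≤ μ 0 u)
    {c : ℕ} (hc1 : 1 ≤ c) (hc : ∀ p' : Fin K, c ≤ (univ.filter (fun r : Fin m => κ r = p')).card) (hmcK : (m : ℝ) ≤ c * K)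
    {A : Finset S} (hφA : ∀ r u, φ r u ∈ A ↔ u ∈ A) {θ p' : ℝ} (hθ0 : 0 < θ) (hθ1 : θ < 1)
    (hcold : ∀ k : Fin (K + 1), k ≠ 0 → ∑ u ∈ A, μ k u = θ) (hhot : ∑ u ∈ A, μ 0 u ≤ p' * θ)
    (hidle : ∀ k : Fin (K + 1), k ≠ 0 → w k * edgeMeasure (μ k) (M k) A Aᶜ = 0)
    {πmin : ℝ} (hmin0 : 0 < πmin) (hmin : ∀ x, πmin ≤ tensorFun μ x) {ε : ℝ} (hε : 0 < ε) (hε2 : ε ≤ 1 / 2) :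
    (2 * (1 - θ) * K / p' - 1) * Real.log (1 / (2 * ε))
        ≤ (mixingTime (fun y z : Fin (K + 1) → S =>
            (1 / 2 : ℝ) * ptGraphSwap μ (fun r : Fin m => (((0 : Fin (K + 1)), (κ r).succ) : Fin (K + 1) × Fin (K + 1))) φ y z
              + (1 - 1 / 2) * prodKernel w M y z) (tensorFun μ) ε : ℝ)
      ∧ mixingTime (fun y z : Fin (K + 1) → S =>
            (1 / 2 : ℝ) * ptGraphSwap μ (fun r : Fin m => (((0 : Fin (K + 1)), (κ r).succ) : Fin (K + 1) × Fin (K + 1))) φ y z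
              + (1 - 1 / 2) * prodKernel w M y z) (tensorFun μ) ε ≤ ⌈14 * K / p * Real.log (1 / (2 * ε * πmin))⌉₊ := by
  have hw00 : 0 < w 0 := by rw [hw01]; exact one_pos
  refine ⟨?_, halfStar_mixingTime_le κ φ hK hm hw0 hw01 hw1 hμ hμ1 hM hMrev hM0 hp0 hp1 hdom hc1 hc hmcK hmin0 hmin hε⟩
  have h := tightSector_mixingTime_ge κ φ hK hm (t := 1 / 2) (by norm_num) (by norm_num) hw0 hw00 hw1 hμ hμ1 hM hMrev hM0 hp0 hp1
    hdom hc1 hc hφA hθ0 hθ1 hcold hhot hidle hε hε2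
  have hmin' : min (1 / 2 : ℝ) ((1 - 1 / 2) * w 0) = 1 / 2 := by rw [hw01]; norm_num
  rw [hmin'] at h
  have e : (1 - θ) * (K : ℝ) / (p' * (1 / 2)) = 2 * (1 - θ) * K / p' := by
    rw [mul_one_div, div_div_eq_mul_div]; ring
  rw [e] at h
  exact h

end Floor

end Summit.Ventures.LatticeQCDFlow.Scaling

end
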